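import Summits.QuantumFields.BalabanUV.Beta.D1BFx.PackedTowerCombine
import Summits.QuantumFields.BalabanUV.Beta.D1BFx.GhostSqrtLegLimit

/-!
# `BalabanUV.Beta.D1BFx.GhostSqrtLegPacked` — road «BF-x» for binder row D1, slot (K), chain step (S-GH) AT THE (A1)-PACKED GHOST TOWER («GH-DICT-PACKED»,
# owner d1-p2 g18 WANTED W-d1p2-g18-6): **`hessKer (Cgh n a) ℒ ℒ₂ μ ν z = 2·hessKer (Ggh n a) (n²•𝒢) (n²•𝒟) μ ν z − R₁₆(n²•𝒢, n²•𝒟)`** for the PACKED ghost tower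
# families `ℒ`, `ℒ₂` of (B6′) `PackedTowerCombine` ∕ PART 3b `PackedLiteralCombine` at ANY bond-indexed decaying weight family `w` — leaf-04's GH-DICT PART 2b
# (`GhostSqrtLegLimit.hessKer_Cgh_Lgh_eq`, single bond) re-run at the packed ghost currents `𝒢[κ′v] := Σ_κ wsum (w κ′ v κ) (ghCur κ)` and the PLAIN diagonal
# pair family `𝒟[κ′v, l v′] := Σ_κ wsum (w κ′ v κ) (u ↦ w l v′ κ u · gh₂ κ u)`

HONEST DEPENDENCY (cell records, verbatim): «continuum YM on T⁴ ⇐ BetaPertH ∧ nine spine estimates (0/9 proved); BetaPertH ⇐ (D1) ∧ (D4) ∧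
CAP+tail; G-an2-4 gates asym, D1 and NE2/3/4.»  HONEST FRAMING (cell contract, verbatim): «discharging `BetaPertH` makes Bałaban's UV stability
UNCONDITIONAL — a real constructive-QFT result; it is NOT the continuum limit and NOT the Clay problem.»  THIS MODULE DISCHARGES NOTHING of (K),
of D1 or of the wall: [folklore] absolutely convergent lattice bookkeeping BY NAME — the torus detour of GH-DICT PART 2b with every socket a tree
theorem: `MovingTableSockets.tendsto_hessT_Cgh_of_uniform` (leaf-03 g21), `GhostSqrtLegLimit.tendsto_hessT_Cgh_biLaplacian_family` + `hat_arr_Lgh`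
(leaf-04 g17), `PeriodicArrayPackingPlain.periodiseF_toF_arr_dirsum_wsum` ∕ `biLoc_dirsum_wsum(_mul)` (leaf-03 g22 FILE 1), `PackedTowerLimits.tendsto_comp_arr_apply`,
`PackedTowerSlotsGram.perT_arr_add₄`, the TA2 product letters `perT_arr_mul_perT` ∕ `perT_mul_perT_arr` ∕ `decays_arr`, Mathlib's `tendsto_nhds_unique`.
No definition, no `def … : Prop`, nothing cited, 0 sorry.  The sixteen remainder words are DISPLAYED, not estimated; the identification of the road's
ghost currents with the END's `wH`-packed ray (the OWNER's located Q-GH-W) is NOT touched here.  0 root-level binders of row D1 discharged (hW ∕ hR-sockets ∕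
hSX-socket ∕ D1Tel ∕ D1Rep = 0); (K) NOT closed; NOT D1, NOT `BetaPertH`, NOT continuum, NOT Clay.

ABSOLUTE RULE (cell charter, verbatim): «No internally-minted statement may enter as a cited fact. Every hypothesis is either kernel-proved in this
package or a verbatim quotation of a PUBLISHED theorem with page reference. The manuscript(s) under audit are NOT citable for their own disputed
steps — they are the thing under adjudication; programme-internal (2001/route/tribunal) claims are never citable.»

WHY (owner d1-p2 g18, WANTED W-d1p2-g18-6 «GH-DICT-PACKED», journal l.40606).  PART 3b `PackedLiteralCombine.hessKer_transfer_road_cov_packed_literal` puts the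
road's ghost tower on `ℤ⁴` as `hessKer (Cgh (m+1) a) ℒ ℒ₂ μ ν z` at the literal's actual packing weights `w := colH G₀ (m+1)`; the (S-GH) line of record reads
the SINGLE-BOND form.  With this file the (K6c) assembly reads the ghost member in the END's `Ggh`-currency at the road's packed currents.
ROUTE (a variant of the OWNER's, no moving-table form of leaf-04's theorem needed): both members are limits of ONE torus sequence
`T_k := hessT ((Cgh n a)^; (arr s_k ℒ[μ0])^, (arr s_k ℒ[νz])^, (arr s_k 𝒴^{s_k})^)`, `s_k := n·(k+1)`, whose pair family
`𝒴ˢ := comp 𝒟 lapU + comp 𝒢[μ0] (arr s 𝒢[νz]) + comp 𝒢[νz] (arr s 𝒢[μ0]) + comp lapU 𝒟` carries the PLAIN diagonal family `𝒟` in the Laplacian slots (only the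
middle products are wrapped, F-g16-1): LEFT `T_k → hessKer (Cgh n a) ℒ ℒ₂ μ ν z` by `tendsto_hessT_Cgh_of_uniform` (§2: `s`-uniform localisation + entrywise
limit of `𝒴ˢ`); per torus `(arr s ℒ[w])^ = (arr s 𝒢[w])^·L̂ + L̂·(arr s 𝒢[w])^` and `(arr s 𝒴ˢ)^ = D̂·L̂ + Ĝ·Ĝ′ + Ĝ′·Ĝ + L̂·D̂` (§1), so `T_k` IS the bi-Laplacian
torus functional of the arrays of the FIXED jets `𝒢`, `𝒟`; RIGHT `T_k → 2·hessKer (Ggh n a) (n²•𝒢) (n²•𝒟) μ ν z − R₁₆` by leaf-04's family theorem; limits are unique.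

CONTENT (all [folklore]; `n ≥ 1` the block side, `0 < a`; `w` with `|w μ 0 κ u| ≤ Cₛ·e^{−δ|u−Pₛ|₁}`, `|w ν z κ u| ≤ Cₜ·e^{−δ|u−Pₜ|₁}`, `0 < δ ≤ ½` — (B6′)'s `hwS hwT hδ hδ1`):
* §1 torus letters **`hat_arr_dirsum_Lgh`** (`(arr (n·p) ℒ[w])^ = (arr (n·p) 𝒢[w])^·L̂ + L̂·(arr (n·p) 𝒢[w])^`), **`hat_arr_pairWord`** (generic bi-localised `A B D`:
  `(arr s (comp D lapU + comp A (arr s B) + comp B (arr s A) + comp lapU D))^ = D̂·L̂ + Â·B̂ + B̂·Â + L̂·D̂`).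
* §2 the sequence's pair family: **`exists_biLoc_plainPair_uniform`** (ONE constant, rate `δ∕16`, every `s ≥ 1`), **`tendsto_plainPair_apply`** (entrywise limit).
* §3 **`hessKer_Cgh_packed_eq`** — the identity above, `ℒ ℒ₂` in (B6′)'s VERBATIM spelling (block side `n`; the road reads it at `n := m+1`, `w := colH G₀ (m+1)`).
Provenance: G-an2-4 swarm leaf seat `b2b-balaban-gan24-formalise-leaf-05` (gen 52), cross-lane for road «BF-x», 2026-08-22; first refusal of the brick was
leaf-04's (W-d1p2-g18-6) — see the journal for the hand-over.
-/

noncomputable section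

namespace Summit.QuantumFields.BalabanUV.Beta.D1BFx.GhostSqrtLegPacked

open Matrix Filter Topology
open scoped BigOperators
open Literature.Probability.LatticeModels (TorusSite)
open Literature.MathematicalPhysics.QuantumFieldTheory.Balaban1983to89
open Literature.MathematicalPhysics.QuantumFieldTheory.Balaban1983to89.Beta
open B12Sec2to5 (l1 l1_nonneg)
open ExpKernelCalculus (MKer BiLoc Decays comp tr tadpole bubble hessKer Zl)
open OneStepResolventKernel (wsum biLoc_wsum)
open KernelWard (biLoc_recentre biLoc_add)
open BalabanStepJetsSucc (biLoc_comp_right)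
open Summit.QuantumFields.BalabanUV.Beta.D1BFx.FibredPeriodisation (periodiseF)
open Summit.QuantumFields.BalabanUV.Beta.D1BFx.SortedReblocking (torusBlockEquiv)
open Summit.QuantumFields.BalabanUV.Beta.D1BFx.PeriodicArrays (arr toF decays_arr arr_imageShift)
open Summit.QuantumFields.BalabanUV.Beta.D1BFx.MixedVarPackedHess (hessT)
open Summit.QuantumFields.BalabanUV.Beta.D1BFx.TorusCombKKT (I)
open Summit.QuantumFields.BalabanUV.Beta.D1BFx.RProjector (Pgt)
open Summit.QuantumFields.BalabanUV.Beta.D1BFx.GhostLeg (Ggh)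
open Summit.QuantumFields.BalabanUV.Beta.D1BFx.GhostStencil (ghCur biLoc_ghCur)
open Summit.QuantumFields.BalabanUV.Beta.D1BFx.KGhostLeg (Cgh)
open Summit.QuantumFields.BalabanUV.Beta.D1BFx.TorusGhostLegs (tendsto_mul_period)
open Summit.QuantumFields.BalabanUV.Beta.D1BFx.TorusGhostWordArrays (perT lapU Lgh perT_add perT_arr_mul_perT perT_mul_perT_arr summable_row_arr arr_add
  decays_lapU lapU_imageShift biLoc_Lgh)
open Summit.QuantumFields.BalabanUV.Beta.D1BFx.TorusGhostPairStencils (gh₂ biLoc_gh₂)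
open Summit.QuantumFields.BalabanUV.Beta.D1BFx.KCombineCovTowers (submatrix_fst_perT)
open Summit.QuantumFields.BalabanUV.Beta.D1BFx.PeriodicArrayPackingPlain (periodiseF_toF_arr_dirsum_wsum biLoc_dirsum_wsum biLoc_dirsum_wsum_mul)
open Summit.QuantumFields.BalabanUV.Beta.D1BFx.PackedTowerSlotsGram (ghCur_imageShift Lgh_imageShift perT_arr_add₄)
open Summit.QuantumFields.BalabanUV.Beta.D1BFx.PackedTowerLimits (tendsto_comp_arr_apply)
open Summit.QuantumFields.BalabanUV.Beta.D1BFx.MovingTableSockets (tendsto_hessT_Cgh_of_uniform)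
open Summit.QuantumFields.BalabanUV.Beta.D1BFx.GhostSqrtLegLimit (hat_arr_Lgh tendsto_hessT_Cgh_biLaplacian_family)

/-! ## §1 Torus letters: the arrays of the packed ghost words are bi-Laplacian words of the arrays of the packed currents -/

section Torus

variable (n p : ℕ) [NeZero n] [NeZero p] {w : Fin 4 → (Fin 4 → ℤ) → ℝ} {C δ : ℝ} {P : Fin 4 → ℤ}

/-- [folklore] **THE ARRAY OF THE PACKED `L̂²`-WORD IS THE BI-LAPLACIAN WORD OF THE ARRAY OF THE PACKED GHOST CURRENT**, every torus `Site 4 (n·p)`: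
`(arr s ℒ[w])^ = (arr s 𝒢[w])^·L̂ + L̂·(arr s 𝒢[w])^`, `ℒ[w] := Σ_κ wsum (w κ) (Lgh κ)`, `𝒢[w] := Σ_κ wsum (w κ) (ghCur κ)`, `L̂ := (lapU)^`
(FILE 1 «PACK-PLAIN» `periodiseF_toF_arr_dirsum_wsum` on both sides + leaf-04's per-bond `hat_arr_Lgh` + finite torus-matrix algebra). -/
theorem hat_arr_dirsum_Lgh (hw : ∀ κ u, |w κ u| ≤ C * Real.exp (-δ * l1 (u - P))) (hδ : 0 < δ) (hδ1 : δ ≤ 1 / 2) :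
    Matrix.of (periodiseF (n * p) (toF (arr (n * p) (fun x y a b => ∑ κ : Fin 4, wsum (w κ) (Lgh κ) x y a b))))
      = Matrix.of (periodiseF (n * p) (toF (arr (n * p) (fun x y a b => ∑ κ : Fin 4, wsum (w κ) (ghCur κ) x y a b))))
          * Matrix.of (periodiseF (n * p) (toF lapU))
        + Matrix.of (periodiseF (n * p) (toF lapU))
          * Matrix.of (periodiseF (n * p) (toF (arr (n * p) (fun x y a b => ∑ κ : Fin 4, wsum (w κ) (ghCur κ) x y a b)))) := by
  have hC : 0 ≤ C := PeriodicArrayWrapLimit.const_nonneg_of_weight (hw 0)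
  have hLgh : ∀ κ u, BiLoc (Lgh κ u) u u TorusGhostWordArrays.cL δ := fun κ u => StepJetData.biLoc_weaken (biLoc_Lgh κ u) le_rfl hδ1
  rw [periodiseF_toF_arr_dirsum_wsum (d := 3) hw hLgh (fun κ u t => Lgh_imageShift _ κ u t) hδ hC,
    periodiseF_toF_arr_dirsum_wsum (d := 3) hw (fun κ u => biLoc_ghCur κ u δ) (fun κ u t => ghCur_imageShift _ κ u t) hδ hC,
    Finset.sum_mul, Matrix.mul_sum, ← Finset.sum_add_distrib]
  refine Finset.sum_congr rfl fun k _ => ?_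
  rw [Matrix.smul_mul, Matrix.mul_smul, ← smul_add, hat_arr_Lgh]

variable {A B D : MKer 4 Unit} {pA pB pD qD : Fin 4 → ℤ} {CA CB CD δ' : ℝ}

omit [NeZero n] in
/-- [folklore] **THE ARRAY OF THE PLAIN PAIR FAMILY IN PRODUCT FORM IS THE BI-LAPLACIAN PAIR WORD OF THE ARRAYS**, every torus `Site 4 s`: for bi-localised `A` (at
`(p_A, p_A)`), `B` (at `(p_B, p_B)`), `D` (at `(p_D, q_D)`),
`(arr s (comp D lapU + comp A (arr s B) + comp B (arr s A) + comp lapU D))^ = D̂·L̂ + Â·B̂ + B̂·Â + L̂·D̂` (`Â := (arr s A)^`, …; the wrap-around of F-g16-1 sits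
INSIDE the middle products as TA2's `arr`: `perT_arr_mul_perT_arr`, `perT_arr_mul_perT`, `perT_mul_perT_arr`, `perT_arr_add₄`). -/
theorem hat_arr_pairWord (s : ℕ) [NeZero s] (hA : BiLoc A pA pA CA δ') (hB : BiLoc B pB pB CB δ') (hD : BiLoc D pD qD CD δ') (hδ' : 0 < δ')
    (hδ1 : δ' ≤ 1) :
    Matrix.of (periodiseF s (toF (arr s (comp D lapU + comp A (arr s B) + comp B (arr s A) + comp lapU D))))
      = Matrix.of (periodiseF s (toF (arr s D))) * Matrix.of (periodiseF s (toF lapU))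
        + Matrix.of (periodiseF s (toF (arr s A))) * Matrix.of (periodiseF s (toF (arr s B)))
        + Matrix.of (periodiseF s (toF (arr s B))) * Matrix.of (periodiseF s (toF (arr s A)))
        + Matrix.of (periodiseF s (toF lapU)) * Matrix.of (periodiseF s (toF (arr s D))) := by
  have hδ2 : 0 < δ' / 2 := half_pos hδ'
  have hδ4 : 0 < δ' / 2 / 2 := half_pos hδ2
  have hL : Decays lapU (|16 * Real.exp 1|) δ' := TameKernelCalculus.decays_of_le decays_lapU hδ1
  have hAA := decays_arr hA hδ' s
  have hAB := decays_arr hB hδ' s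
  -- the four pieces are bi-localised (any constants, any positive rates suffice for the additivity)
  have hP1 := biLoc_comp_right hD hL hδ2.le (half_lt_self hδ')
  have hP4 := ExpKernelCalculus.biLoc_comp_decays hL hD hδ2.le (half_lt_self hδ')
  have hP2 := biLoc_comp_right (StepJetData.biLoc_weaken hA le_rfl (half_le_self hδ'.le)) hAB hδ4.le (half_lt_self hδ2)
  have hP3 := biLoc_comp_right (StepJetData.biLoc_weaken hB le_rfl (half_le_self hδ'.le)) hAA hδ4.le (half_lt_self hδ2)
  -- the identity in `perT` currency (TA2 product letters), then read on `Site × Unit`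
  have h : perT s (arr s (comp D lapU + comp A (arr s B) + comp B (arr s A) + comp lapU D))
      = perT s (arr s D) * perT s lapU + perT s (arr s A) * perT s (arr s B) + perT s (arr s B) * perT s (arr s A)
        + perT s lapU * perT s (arr s D) := by
    rw [perT_arr_mul_perT _ decays_lapU one_pos (fun x y t a b => lapU_imageShift _ x y t a b) hD hδ',
      perT_arr_mul_perT _ hAB hδ2 (fun x y t a b => arr_imageShift s B x y t a b) hA hδ',
      perT_arr_mul_perT _ hAA hδ2 (fun x y t a b => arr_imageShift s A x y t a b) hB hδ',
      perT_mul_perT_arr _ decays_lapU one_pos (fun x y t a b => lapU_imageShift _ x y t a b) hD hδ',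
      perT_arr_add₄ _ hP1 hδ2 hP2 hδ4 hP3 hδ4 hP4 hδ2]
  have hbij : Function.Bijective (Prod.fst : Site 4 s × Unit → Site 4 s) := (Equiv.prodPUnit (Site 4 s)).bijective
  rw [← submatrix_fst_perT, h]
  simp only [Matrix.submatrix_add, Pi.add_apply, Matrix.submatrix_mul _ _ Prod.fst Prod.fst Prod.fst hbij, submatrix_fst_perT]

end Torus

/-! ## §2 The torus sequence with the PLAIN diagonal pair family: uniform localisation, entrywise limit, and its `Cgh` limit -/

section Sequence

variable (n : ℕ) [NeZero n] {a : ℝ}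

/-- [folklore] **UNIFORM LOCALISATION OF THE PLAIN-DIAGONAL PAIR FAMILY IN PRODUCT FORM**: for weight families `wₛ` (centre `Pₛ`), `wₜ` (centre `Pₜ`) decaying at a
rate `0 < δ ≤ ½`, there is ONE constant `C` with `BiLoc 𝒴ˢ Pₛ Pₜ C (δ∕16)` for EVERY period `s ≥ 1`,
`𝒴ˢ := comp 𝒟 lapU + comp 𝒢ₛ (arr s 𝒢ₜ) + comp 𝒢ₜ (arr s 𝒢ₛ) + comp lapU 𝒟` with the PLAIN diagonal family `𝒟 := Σ_κ wsum (wₛ κ) (u ↦ wₜ κ u · gh₂ κ u)`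
(leaf-03 g22's `PackedTowerLimits.exists_biLoc_gramPair_uniform` with the periodised-weight diagonal family replaced by the plain one — FILE 1 `biLoc_dirsum_wsum_mul`). -/
theorem exists_biLoc_plainPair_uniform (wS wT : Fin 4 → (Fin 4 → ℤ) → ℝ) {CS CT δ : ℝ} {PS PT : Fin 4 → ℤ}
    (hwS : ∀ κ u, |wS κ u| ≤ CS * Real.exp (-δ * l1 (u - PS))) (hwT : ∀ κ u, |wT κ u| ≤ CT * Real.exp (-δ * l1 (u - PT))) (hδ : 0 < δ)
    (hδ1 : δ ≤ 1 / 2) :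
    ∃ C : ℝ, ∀ s : ℕ, NeZero s →
      BiLoc (comp (fun x y a b => ∑ κ : Fin 4, wsum (wS κ) (fun u => fun x y a b => wT κ u * gh₂ κ u x y a b) x y a b) lapU
            + comp (fun x y a b => ∑ κ : Fin 4, wsum (wS κ) (ghCur κ) x y a b)
                (arr s (fun x y a b => ∑ κ : Fin 4, wsum (wT κ) (ghCur κ) x y a b))
            + comp (fun x y a b => ∑ κ : Fin 4, wsum (wT κ) (ghCur κ) x y a b)
                (arr s (fun x y a b => ∑ κ : Fin 4, wsum (wS κ) (ghCur κ) x y a b))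
            + comp lapU (fun x y a b => ∑ κ : Fin 4, wsum (wS κ) (fun u => fun x y a b => wT κ u * gh₂ κ u x y a b) x y a b))
        PS PT C (δ / 2 / 2 / 2 / 2) := by
  have hCS : 0 ≤ CS := PeriodicArrayWrapLimit.const_nonneg_of_weight (hwS 0)
  have hCT : 0 ≤ CT := PeriodicArrayWrapLimit.const_nonneg_of_weight (hwT 0)
  have hδ2 : 0 < δ / 2 := half_pos hδ
  have hδ4 : 0 < δ / 2 / 2 := half_pos hδ2
  have hδ8 : 0 < δ / 2 / 2 / 2 := half_pos hδ4
  have hδ16 : 0 < δ / 2 / 2 / 2 / 2 := half_pos hδ8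
  have hGS := biLoc_dirsum_wsum (d := 3) hwS (fun κ u => biLoc_ghCur κ u δ) hδ hCS
  have hGT := biLoc_dirsum_wsum (d := 3) hwT (fun κ u => biLoc_ghCur κ u δ) hδ hCT
  have hL : Decays lapU (|16 * Real.exp 1|) (δ / 2) := TameKernelCalculus.decays_of_le decays_lapU (by linarith)
  have hD := biLoc_dirsum_wsum_mul (d := 3) hwS hwT (fun κ u => biLoc_gh₂ κ u δ) hδ hCS
  refine ⟨?_, fun s hs => ?_⟩
  swap
  haveI : NeZero s := hs
  have hAS := decays_arr hGS hδ2 s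
  have hAT := decays_arr hGT hδ2 s
  -- the four pieces, each at rate `δ/16`, re-centred to `(Pₛ, Pₜ)`
  have hP1 := biLoc_recentre (StepJetData.biLoc_weaken (biLoc_comp_right hD hL hδ4.le (half_lt_self hδ2)) le_rfl
    (by linarith : δ / 2 / 2 / 2 / 2 ≤ δ / 2 / 2)) hδ16.le PS PT
  have hP4 := biLoc_recentre (StepJetData.biLoc_weaken (ExpKernelCalculus.biLoc_comp_decays hL hD hδ4.le (half_lt_self hδ2)) le_rfl
    (by linarith : δ / 2 / 2 / 2 / 2 ≤ δ / 2 / 2)) hδ16.le PS PT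
  have hP2 := biLoc_recentre (StepJetData.biLoc_weaken
    (biLoc_comp_right (StepJetData.biLoc_weaken hGS le_rfl (half_le_self hδ2.le)) hAT hδ8.le (half_lt_self hδ4)) le_rfl
    (by linarith : δ / 2 / 2 / 2 / 2 ≤ δ / 2 / 2 / 2)) hδ16.le PS PT
  have hP3 := biLoc_recentre (StepJetData.biLoc_weaken
    (biLoc_comp_right (StepJetData.biLoc_weaken hGT le_rfl (half_le_self hδ2.le)) hAS hδ8.le (half_lt_self hδ4)) le_rfl
    (by linarith : δ / 2 / 2 / 2 / 2 ≤ δ / 2 / 2 / 2)) hδ16.le PS PT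
  exact biLoc_add (biLoc_add (biLoc_add hP1 hP2) hP3) hP4

/-- [folklore] **THE PLAIN-DIAGONAL PAIR FAMILY'S ENTRYWISE LIMIT**: along periods `σ k → ∞`, `𝒴^{σ k} x y a b → (comp 𝒟 lapU + comp 𝒢ₛ 𝒢ₜ + comp 𝒢ₜ 𝒢ₛ + comp lapU 𝒟) x y a b`
(only the two middle products move: leaf-03 g22's `tendsto_comp_arr_apply`). -/
theorem tendsto_plainPair_apply (wS wT : Fin 4 → (Fin 4 → ℤ) → ℝ) {CS CT δ : ℝ} {PS PT : Fin 4 → ℤ}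
    (hwS : ∀ κ u, |wS κ u| ≤ CS * Real.exp (-δ * l1 (u - PS))) (hwT : ∀ κ u, |wT κ u| ≤ CT * Real.exp (-δ * l1 (u - PT))) (hδ : 0 < δ)
    {σ : ℕ → ℕ} (hσ : Tendsto σ atTop atTop) (x y : Fin 4 → ℤ) (a b : Unit) :
    Tendsto (fun k =>
        (comp (fun x y a b => ∑ κ : Fin 4, wsum (wS κ) (fun u => fun x y a b => wT κ u * gh₂ κ u x y a b) x y a b) lapU
            + comp (fun x y a b => ∑ κ : Fin 4, wsum (wS κ) (ghCur κ) x y a b)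
                (arr (σ k) (fun x y a b => ∑ κ : Fin 4, wsum (wT κ) (ghCur κ) x y a b))
            + comp (fun x y a b => ∑ κ : Fin 4, wsum (wT κ) (ghCur κ) x y a b)
                (arr (σ k) (fun x y a b => ∑ κ : Fin 4, wsum (wS κ) (ghCur κ) x y a b))
            + comp lapU (fun x y a b => ∑ κ : Fin 4, wsum (wS κ) (fun u => fun x y a b => wT κ u * gh₂ κ u x y a b) x y a b)) x y a b) atTop
      (𝓝 ((comp (fun x y a b => ∑ κ : Fin 4, wsum (wS κ) (fun u => fun x y a b => wT κ u * gh₂ κ u x y a b) x y a b) lapU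
            + comp (fun x y a b => ∑ κ : Fin 4, wsum (wS κ) (ghCur κ) x y a b) (fun x y a b => ∑ κ : Fin 4, wsum (wT κ) (ghCur κ) x y a b)
            + comp (fun x y a b => ∑ κ : Fin 4, wsum (wT κ) (ghCur κ) x y a b) (fun x y a b => ∑ κ : Fin 4, wsum (wS κ) (ghCur κ) x y a b)
            + comp lapU (fun x y a b => ∑ κ : Fin 4, wsum (wS κ) (fun u => fun x y a b => wT κ u * gh₂ κ u x y a b) x y a b)) x y a b)) := by
  have hCS : 0 ≤ CS := PeriodicArrayWrapLimit.const_nonneg_of_weight (hwS 0)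
  have hCT : 0 ≤ CT := PeriodicArrayWrapLimit.const_nonneg_of_weight (hwT 0)
  have hδ2 : 0 < δ / 2 := half_pos hδ
  have hGS := biLoc_dirsum_wsum (d := 3) hwS (fun κ u => biLoc_ghCur κ u δ) hδ hCS
  have hGT := biLoc_dirsum_wsum (d := 3) hwT (fun κ u => biLoc_ghCur κ u δ) hδ hCT
  simp only [Pi.add_apply]
  exact ((tendsto_const_nhds.add (tendsto_comp_arr_apply hGS hδ2 hGT hδ2 hσ x y a b)).add
    (tendsto_comp_arr_apply hGT hδ2 hGS hδ2 hσ x y a b)).add tendsto_const_nhds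

end Sequence

/-! ## §3 «GH-DICT-PACKED»: the ghost slot of (B6′) ∕ PART 3b in the `Ggh`-currency, at ANY bond-indexed decaying weight family -/

section Packed

variable (n : ℕ) [NeZero n] {a : ℝ}

/-- [folklore] **«GH-DICT-PACKED» — GH-DICT PART 2b AT THE (A1)-PACKED GHOST TOWER.**  For `0 < a`, block side `n ≥ 1`, a bond-indexed p-FREE weight family
`w` with decay letters at the base bonds `(μ,0)`, `(ν,z)` (rate `0 < δ ≤ ½`; in the road `w := colH G₀ n`, (B6′) `PackedTowerCombine` ∕ PART 3b `PackedLiteralCombine`):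
`hessKer (Cgh n a) ℒ ℒ₂ μ ν z = 2·hessKer (Ggh n a) (n²•𝒢) (n²•𝒟) μ ν z − R₁₆(n²•𝒢[μ0], n²•𝒢[νz], n²•𝒟[μ0,νz])`, where
`ℒ κ′ v := Σ_κ wsum (w κ′ v κ) (Lgh κ)` and `ℒ₂ := comp 𝒟 lapU + comp 𝒢[κ′v] 𝒢[l v′] + comp 𝒢[l v′] 𝒢[κ′v] + comp lapU 𝒟` are (B6′)'s PACKED ghost tower families VERBATIM,
`𝒢[κ′v] := Σ_κ wsum (w κ′ v κ) (ghCur κ)` the packed ghost current, `𝒟[κ′v, l v′] := Σ_κ wsum (w κ′ v κ) (u ↦ w l v′ κ u · gh₂ κ u)` the PLAIN diagonal pair family, and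
`R₁₆` the sixteen `ℤ⁴` trace words of `GhostSqrtLegLimit.tendsto_hessT_Cgh_biLaplacian_family` (legs `Pgt∘Ggh`, `Ggh∘Pgt`, `Ggh∘Ggh`, `Ggh∘(Pgt∘Ggh)`, `Pgt`, `Ggh`).
PROOF: both members are limits of ONE torus sequence `hessT ((Cgh)^; (arr s_k ℒ[μ0])^, (arr s_k ℒ[νz])^, (arr s_k 𝒴^{s_k})^)`, `s_k = n·(k+1)`, with the PLAIN-diagonal
pair family `𝒴ˢ` of §2 — `MovingTableSockets.tendsto_hessT_Cgh_of_uniform` (left; §2's uniform localisation and entrywise limit) and leaf-04's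
`tendsto_hessT_Cgh_biLaplacian_family` at the FIXED jets `𝒢`, `𝒟` (right; per torus §1's `hat_arr_dirsum_Lgh` ∕ `hat_arr_pairWord`) — and `tendsto_nhds_unique`. -/
theorem hessKer_Cgh_packed_eq (ha : 0 < a) (w : Fin 4 → (Fin 4 → ℤ) → Fin 4 → (Fin 4 → ℤ) → ℝ) (μ ν : Fin 4) (z : Fin 4 → ℤ)
    {CS CT δ : ℝ} {PS PT : Fin 4 → ℤ}
    (hwS : ∀ κ u, |w μ 0 κ u| ≤ CS * Real.exp (-δ * l1 (u - PS))) (hwT : ∀ κ u, |w ν z κ u| ≤ CT * Real.exp (-δ * l1 (u - PT))) (hδ : 0 < δ)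
    (hδ1 : δ ≤ 1 / 2) :
    hessKer (Cgh n a) (fun κ' v => fun x y a b => ∑ κ : Fin 4, wsum (w κ' v κ) (Lgh κ) x y a b)
        (fun κ' v l v' =>
          comp (fun x y a b => ∑ κ : Fin 4, wsum (w κ' v κ) (fun u => fun x y a b => w l v' κ u * gh₂ κ u x y a b) x y a b) lapU
            + comp (fun x y a b => ∑ κ : Fin 4, wsum (w κ' v κ) (ghCur κ) x y a b) (fun x y a b => ∑ κ : Fin 4, wsum (w l v' κ) (ghCur κ) x y a b)
            + comp (fun x y a b => ∑ κ : Fin 4, wsum (w l v' κ) (ghCur κ) x y a b) (fun x y a b => ∑ κ : Fin 4, wsum (w κ' v κ) (ghCur κ) x y a b)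
            + comp lapU (fun x y a b => ∑ κ : Fin 4, wsum (w κ' v κ) (fun u => fun x y a b => w l v' κ u * gh₂ κ u x y a b) x y a b))
        μ ν z
      = 2 * hessKer (Ggh n a) (fun κ' v => ((n : ℝ) ^ 2) • (fun x y a b => ∑ κ : Fin 4, wsum (w κ' v κ) (ghCur κ) x y a b))
          (fun κ' v l v' => ((n : ℝ) ^ 2) • (fun x y a b => ∑ κ : Fin 4,
            wsum (w κ' v κ) (fun u => fun x y a b => w l v' κ u * gh₂ κ u x y a b) x y a b)) μ ν z
        - ((1 / 2) * (tr (comp (comp (Pgt n a) (Ggh n a))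
              (((n : ℝ) ^ 2) • (fun x y a b => ∑ κ : Fin 4, wsum (w μ 0 κ) (fun u => fun x y a b => w ν z κ u * gh₂ κ u x y a b) x y a b)))
            + tr (comp (comp (Ggh n a) (Pgt n a))
              (((n : ℝ) ^ 2) • (fun x y a b => ∑ κ : Fin 4, wsum (w μ 0 κ) (fun u => fun x y a b => w ν z κ u * gh₂ κ u x y a b) x y a b)))
            + tr (comp (comp (comp (Ggh n a) (comp (Pgt n a) (Ggh n a))) (((n : ℝ) ^ 2) • (fun x y a b => ∑ κ : Fin 4, wsum (w μ 0 κ) (ghCur κ) x y a b)))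
              (((n : ℝ) ^ 2) • (fun x y a b => ∑ κ : Fin 4, wsum (w ν z κ) (ghCur κ) x y a b)))
            + tr (comp (comp (comp (Ggh n a) (comp (Pgt n a) (Ggh n a))) (((n : ℝ) ^ 2) • (fun x y a b => ∑ κ : Fin 4, wsum (w ν z κ) (ghCur κ) x y a b)))
              (((n : ℝ) ^ 2) • (fun x y a b => ∑ κ : Fin 4, wsum (w μ 0 κ) (ghCur κ) x y a b))))
          - (1 / 2) * (tr (comp (comp (Ggh n a) (((n : ℝ) ^ 2) • (fun x y a b => ∑ κ : Fin 4, wsum (w μ 0 κ) (ghCur κ) x y a b))) (comp (comp (Pgt n a) (Ggh n a))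
              (((n : ℝ) ^ 2) • (fun x y a b => ∑ κ : Fin 4, wsum (w ν z κ) (ghCur κ) x y a b))))
            + tr (comp (comp (comp (Pgt n a) (Ggh n a)) (((n : ℝ) ^ 2) • (fun x y a b => ∑ κ : Fin 4, wsum (w μ 0 κ) (ghCur κ) x y a b))) (comp (Ggh n a)
              (((n : ℝ) ^ 2) • (fun x y a b => ∑ κ : Fin 4, wsum (w ν z κ) (ghCur κ) x y a b))))
            + tr (comp (comp (comp (Ggh n a) (Ggh n a)) (((n : ℝ) ^ 2) • (fun x y a b => ∑ κ : Fin 4, wsum (w μ 0 κ) (ghCur κ) x y a b))) (comp (Pgt n a)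
              (((n : ℝ) ^ 2) • (fun x y a b => ∑ κ : Fin 4, wsum (w ν z κ) (ghCur κ) x y a b))))
            + tr (comp (comp (comp (Ggh n a) (comp (Pgt n a) (Ggh n a))) (((n : ℝ) ^ 2) • (fun x y a b => ∑ κ : Fin 4, wsum (w μ 0 κ) (ghCur κ) x y a b)))
              (((n : ℝ) ^ 2) • (fun x y a b => ∑ κ : Fin 4, wsum (w ν z κ) (ghCur κ) x y a b)))
            + tr (comp (comp (comp (Ggh n a) (comp (Pgt n a) (Ggh n a))) (((n : ℝ) ^ 2) • (fun x y a b => ∑ κ : Fin 4, wsum (w ν z κ) (ghCur κ) x y a b)))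
              (((n : ℝ) ^ 2) • (fun x y a b => ∑ κ : Fin 4, wsum (w μ 0 κ) (ghCur κ) x y a b)))
            + tr (comp (comp (Pgt n a) (((n : ℝ) ^ 2) • (fun x y a b => ∑ κ : Fin 4, wsum (w μ 0 κ) (ghCur κ) x y a b))) (comp (comp (Ggh n a) (Ggh n a))
              (((n : ℝ) ^ 2) • (fun x y a b => ∑ κ : Fin 4, wsum (w ν z κ) (ghCur κ) x y a b))))
            + tr (comp (comp (Ggh n a) (((n : ℝ) ^ 2) • (fun x y a b => ∑ κ : Fin 4, wsum (w μ 0 κ) (ghCur κ) x y a b))) (comp (comp (Ggh n a) (Pgt n a))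
              (((n : ℝ) ^ 2) • (fun x y a b => ∑ κ : Fin 4, wsum (w ν z κ) (ghCur κ) x y a b))))
            + tr (comp (comp (comp (Ggh n a) (Pgt n a)) (((n : ℝ) ^ 2) • (fun x y a b => ∑ κ : Fin 4, wsum (w μ 0 κ) (ghCur κ) x y a b))) (comp (Ggh n a)
              (((n : ℝ) ^ 2) • (fun x y a b => ∑ κ : Fin 4, wsum (w ν z κ) (ghCur κ) x y a b)))))
          + (1 / 2) * (tr (comp (comp (comp (Pgt n a) (Ggh n a)) (((n : ℝ) ^ 2) • (fun x y a b => ∑ κ : Fin 4, wsum (w μ 0 κ) (ghCur κ) x y a b)))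
              (comp (comp (Pgt n a) (Ggh n a)) (((n : ℝ) ^ 2) • (fun x y a b => ∑ κ : Fin 4, wsum (w ν z κ) (ghCur κ) x y a b))))
            + tr (comp (comp (comp (Ggh n a) (comp (Pgt n a) (Ggh n a))) (((n : ℝ) ^ 2) • (fun x y a b => ∑ κ : Fin 4, wsum (w μ 0 κ) (ghCur κ) x y a b))) (comp (Pgt n a)
              (((n : ℝ) ^ 2) • (fun x y a b => ∑ κ : Fin 4, wsum (w ν z κ) (ghCur κ) x y a b))))
            + tr (comp (comp (Pgt n a) (((n : ℝ) ^ 2) • (fun x y a b => ∑ κ : Fin 4, wsum (w μ 0 κ) (ghCur κ) x y a b))) (comp (comp (Ggh n a) (comp (Pgt n a) (Ggh n a)))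
              (((n : ℝ) ^ 2) • (fun x y a b => ∑ κ : Fin 4, wsum (w ν z κ) (ghCur κ) x y a b))))
            + tr (comp (comp (comp (Ggh n a) (Pgt n a)) (((n : ℝ) ^ 2) • (fun x y a b => ∑ κ : Fin 4, wsum (w μ 0 κ) (ghCur κ) x y a b))) (comp (comp (Ggh n a) (Pgt n a))
              (((n : ℝ) ^ 2) • (fun x y a b => ∑ κ : Fin 4, wsum (w ν z κ) (ghCur κ) x y a b)))))) := by
  have hCS : 0 ≤ CS := PeriodicArrayWrapLimit.const_nonneg_of_weight (hwS 0)
  have hCT : 0 ≤ CT := PeriodicArrayWrapLimit.const_nonneg_of_weight (hwT 0)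
  have hδ2 : 0 < δ / 2 := half_pos hδ
  have hδ16 : 0 < δ / 2 / 2 / 2 / 2 := half_pos (half_pos (half_pos hδ2))
  have hp : Tendsto (fun k : ℕ => k + 1) atTop atTop := tendsto_add_atTop_nat 1
  -- the packed currents and the plain diagonal pair family are bi-localised at the base bonds (FILE 1), common rate `δ/2`
  have hGS := biLoc_dirsum_wsum (d := 3) hwS (fun κ u => biLoc_ghCur κ u δ) hδ hCS
  have hGT := biLoc_dirsum_wsum (d := 3) hwT (fun κ u => biLoc_ghCur κ u δ) hδ hCT
  have hD := biLoc_dirsum_wsum_mul (d := 3) hwS hwT (fun κ u => biLoc_gh₂ κ u δ) hδ hCS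
  have hD' := biLoc_recentre hD hδ2.le PS PT
  -- RIGHT: the bi-Laplacian words of the arrays of the FIXED jets `𝒢`, `𝒟` (leaf-04's GH-DICT PART 2b, family form)
  have h2 := tendsto_hessT_Cgh_biLaplacian_family n a ha (p := fun k => k + 1)
    (fun κ' v => fun x y a b => ∑ κ : Fin 4, wsum (w κ' v κ) (ghCur κ) x y a b)
    (fun κ' v l v' => fun x y a b => ∑ κ : Fin 4, wsum (w κ' v κ) (fun u => fun x y a b => w l v' κ u * gh₂ κ u x y a b) x y a b)
    μ ν z hGS hGT hD' hδ2 hp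
  -- LEFT: `Cgh` against the arrays of the packed words, the pair family MOVING (plain diagonal, wrapped middle products)
  have hLgh : ∀ κ u, BiLoc (Lgh κ u) u u TorusGhostWordArrays.cL δ := fun κ u => StepJetData.biLoc_weaken (biLoc_Lgh κ u) le_rfl hδ1
  have hV := StepJetData.biLoc_weaken (biLoc_dirsum_wsum (d := 3) hwS hLgh hδ hCS) le_rfl (by linarith : δ / 2 / 2 / 2 / 2 ≤ δ / 2)
  have hV' := StepJetData.biLoc_weaken (biLoc_dirsum_wsum (d := 3) hwT hLgh hδ hCT) le_rfl (by linarith : δ / 2 / 2 / 2 / 2 ≤ δ / 2)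
  obtain ⟨C, hC⟩ := exists_biLoc_plainPair_uniform (w μ 0) (w ν z) hwS hwT hδ hδ1
  have h1 := tendsto_hessT_Cgh_of_uniform n a ha
    (fun _ => fun κ' v => fun x y a b => ∑ κ : Fin 4, wsum (w κ' v κ) (Lgh κ) x y a b)
    (fun k => fun κ' v l v' =>
      comp (fun x y a b => ∑ κ : Fin 4, wsum (w κ' v κ) (fun u => fun x y a b => w l v' κ u * gh₂ κ u x y a b) x y a b) lapU
        + comp (fun x y a b => ∑ κ : Fin 4, wsum (w κ' v κ) (ghCur κ) x y a b)
            (arr (n * (k + 1)) (fun x y a b => ∑ κ : Fin 4, wsum (w l v' κ) (ghCur κ) x y a b))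
        + comp (fun x y a b => ∑ κ : Fin 4, wsum (w l v' κ) (ghCur κ) x y a b)
            (arr (n * (k + 1)) (fun x y a b => ∑ κ : Fin 4, wsum (w κ' v κ) (ghCur κ) x y a b))
        + comp lapU (fun x y a b => ∑ κ : Fin 4, wsum (w κ' v κ) (fun u => fun x y a b => w l v' κ u * gh₂ κ u x y a b) x y a b))
    (fun κ' v => fun x y a b => ∑ κ : Fin 4, wsum (w κ' v κ) (Lgh κ) x y a b)
    (fun κ' v l v' =>
      comp (fun x y a b => ∑ κ : Fin 4, wsum (w κ' v κ) (fun u => fun x y a b => w l v' κ u * gh₂ κ u x y a b) x y a b) lapU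
        + comp (fun x y a b => ∑ κ : Fin 4, wsum (w κ' v κ) (ghCur κ) x y a b) (fun x y a b => ∑ κ : Fin 4, wsum (w l v' κ) (ghCur κ) x y a b)
        + comp (fun x y a b => ∑ κ : Fin 4, wsum (w l v' κ) (ghCur κ) x y a b) (fun x y a b => ∑ κ : Fin 4, wsum (w κ' v κ) (ghCur κ) x y a b)
        + comp lapU (fun x y a b => ∑ κ : Fin 4, wsum (w κ' v κ) (fun u => fun x y a b => w l v' κ u * gh₂ κ u x y a b) x y a b))
    μ ν z (fun _ => hV) (fun _ => hV') (fun k => hC (n * (k + 1)) inferInstance) hδ16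
    (fun _ _ _ _ => tendsto_const_nhds) (fun _ _ _ _ => tendsto_const_nhds)
    (fun x y u v => tendsto_plainPair_apply (w μ 0) (w ν z) hwS hwT hδ (tendsto_mul_period n hp) x y u v) hp
  -- PER TORUS the two sequences agree (§1), and limits in `ℝ` are unique
  refine tendsto_nhds_unique (h1.congr fun k => ?_) h2
  rw [hat_arr_dirsum_Lgh n (k + 1) hwS hδ hδ1, hat_arr_dirsum_Lgh n (k + 1) hwT hδ hδ1,
    hat_arr_pairWord (n * (k + 1)) hGS hGT hD hδ2 (by linarith)]

end Packed


end Summit.QuantumFields.BalabanUV.Beta.D1BFx.GhostSqrtLegPacked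

end
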